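import Summits.BirchSwinnertonDyer.BirchSwinnertonDyer.Theorems.AlignedTransportAtTwoMainConjectureOfRankZeroBSDAtTwoEisensteinRigidityIrreducible
import Literature.NumberTheory.EllipticCurves.IwasawaAlgebraCharIdealProofs
import Mathlib.RingTheory.PowerSeries.WeierstrassPreparation
import Mathlib.RingTheory.Polynomial.Eisenstein.Basic
import HarnessLib

/-!
# Route `AlignedTransportAtTwo`, crux C2 `MainConjectureOfRankZeroBSDAtTwo` (stmt-BirchSwinnertonDyer-22298):
# PRIMES IN `Λ = ℤ_p⟦T⟧` AND THE GENERAL CONSERVATION LAW — the Weierstrass polynomial decides primality, EISENSTEIN ⇒ PRIME,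
# and every divisor of `c·P₁⋯P_r` (`Pᵢ` prime) is `p^m·∏_{i∈S} Pᵢ` up to a unit: `λ = Σ_S λ(Pᵢ)`, `‖F(0)‖ = p^{−m}·∏_S ‖Pᵢ(0)‖`

HONEST FRAMING (cell `bsd-f1-sign2`, WIDTH-5 attached prover seat `bsd-line-att-p5` gen 35 on line `birth` of the lead
`bsd-line-att-p2`; `--supports` stmt-BirchSwinnertonDyer-22298, closes nothing; BSD is NOT proved by any of this; the crux C2, its
verdict «blocked-on `Rank1Residual.GreenbergMuConjectureIrreducible`» and every registered stub are untouched). PURE COMMUTATIVE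
ALGEBRA over `Λ = ℤ_p⟦T⟧` — THEOREMS ONLY (no `def`, no named fact, no `sorry`). Sequel of this seat's `…EisensteinRigidity`
(g34: `‖H(0)‖ = p⁻¹ ⇒ H` IRREDUCIBLE, root-free) and `…EisensteinRigidityIrreducible` (the irreducible-cofactor law), answering g34's
successor item (ii) «Eisenstein ⇒ PRIME in `Λ`» and the memo's «conservation law (pen, UFD)» WITHOUT unique factorisation of `Λ`:
the only certificate is PRIMALITY of the factors, and primality is decided by the Weierstrass polynomial.

* §1 THE WEIERSTRASS POLYNOMIAL DECIDES PRIMALITY. For a Weierstrass factorisation `g = P·u` (`P ∈ ℤ_p[X]` distinguished, `u ∈ Λˣ`;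
  Mathlib `PowerSeries.IsWeierstrassFactorization`): ★ `prime_of_isWeierstrassFactorization` — **`P` prime in `ℤ_p[X]` ⇒ `g` prime in `Λ`**
  (the tree's `span_coe_isPrime_of_dvd`: Weierstrass division `ℤ_p[X]/(P) ≅ Λ/(P)`), and conversely `prime_polynomial_of_isWeierstrassFactorization`
  (**`g` prime ⇒ `P` prime**, the same isomorphism transporting «domain»); `prime_iff_prime_weierstrassDistinguished`; the Weierstrass degree is
  `λ`: `natDegree_eq_lam_of_isWeierstrassFactorization`.
* §2 ★★ `prime_of_norm_constantCoeff` — **EVERY `H ∈ ℤ_p⟦T⟧` WITH `‖H(0)‖ = p⁻¹` IS PRIME** (no `μ`-hypothesis): either `p ∣ H` and then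
  `H = p·unit`, or the Weierstrass polynomial of `H` is an EISENSTEIN polynomial (`isEisensteinAt_of_isWeierstrassFactorization`), irreducible by
  Mathlib's Eisenstein criterion, prime in the UFD `ℤ_p[X]`, hence prime in `Λ` by §1. Upgrades g34's `irreducible_of_norm_constantCoeff`.
* §3 `prime_X_sub_C_of_norm_lt_one` / `prime_X_add_C_of_norm_lt_one` — **the linear factors `T ∓ r`, `‖r‖ < 1`, are prime** (any depth of the
  root; the tree's `prime_X_add_C_two` is the case `r = 2`).
* §4 THE GENERAL CONSERVATION LAW. ★ `exists_le_associated_prod_of_mul_eq_prod` (any cancellative commutative monoid with zero):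
  **`a·b = ∏ S` with every member of the multiset `S` prime ⇒ `a ~ ∏ T` for a sub-multiset `T ≤ S`** — no UFD, induction on `S`;
  `exists_le_associated_prod_of_mul_eq_C_mul_prod` (a unit constant in front); in `Λ`-currency (`λ`, `μ` additive, norms multiplicative):
  `lam_multiset_prod`, `mu_multiset_prod`, `norm_constantCoeff_multiset_prod`; ★★ `divisor_of_C_pow_mul_prod` — **`F·A = C(p^n)·∏ S`, members of `S`
  prime and `p`-free ⇒ `λ(F) = Σ_T λ(P)`, `μ(F) = m ≤ n`, `‖F(0)‖ = p^{−m}·∏_T ‖P(0)‖` for some `T ≤ S`**: Kato's shape `f_X·a = pⁿ·L₀` with a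
  PRIME FACTORISATION `L₀ = ∏ S` forces `char X = p^{μ}·∏_{kept} P`, and once BSD pins `‖f_X(0)‖ = ‖L₀(0)‖` the `μ`-invariant is EXACTLY the
  total weight `Σ_{dropped} ord_p P(0)` of the dropped prime factors (curve side: companion file `…EisensteinRigidityPrimeRoad`).
  `exists_eq_mul_or_of_mul_eq_C_mul_mul` — the one-step peeling form (`Q` prime: `Q ∣ F` or the equation descends to the cofactor).

References: L. Washington, GTM 83, §7.1 (Prop. 7.2 Weierstrass division, Thm. 7.3 preparation, distinguished and Eisenstein polynomials), §13.2
[Washington1997]; S. Lang, Cyclotomic Fields I–II, Ch. 5 §2–3 [Lang1990Cyclotomic]; R. Greenberg, LNM 1716 (1999), §5 pp. 176–182 (conductor 69 at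
`p = 2`: «`f_E(0) ∼ 2`. Hence `f_E(T)` is an irreducible element of `Λ`») [GreenbergLNM1716]; K. Kato, Astérisque 295 (2004), Thm. 17.4 [Kato2004Asterisque].
-/

set_option linter.dupNamespace false
set_option autoImplicit false

noncomputable section

open scoped Classical Polynomial

namespace Summit.BirchSwinnertonDyer.BirchSwinnertonDyer.Theorems.AlignedTransportAtTwoEisensteinRigidityPrime

open PowerSeries Literature.NumberTheory.EllipticCurves
  Summit.BirchSwinnertonDyer.Rank1Residual.X1.MuLambda
  Summit.BirchSwinnertonDyer.BirchSwinnertonDyer.Theorems.AlignedTransportAtTwoTwoFixedPoints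
  Summit.BirchSwinnertonDyer.BirchSwinnertonDyer.Theorems.AlignedTransportAtTwoEisensteinRigidity

variable {p : ℕ} [Fact p.Prime]

/-! ## §1 The Weierstrass polynomial decides primality in `Λ` -/

/-- ★ **A Weierstrass factorisation `g = P·u` with `P` PRIME in `ℤ_p[X]` makes `g` PRIME in `Λ = ℤ_p⟦T⟧`**: Weierstrass division gives
`ℤ_p[X]/(P) ≅ Λ/(P)` (tree `span_coe_isPrime_of_dvd`, Mathlib `Polynomial.IsDistinguishedAt.algEquivQuotient`), so `(P) ⊂ Λ` is a prime ideal,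
and `g ~ P`. [cite: Washington1997, Prop. 7.2 and §13.2] -/
theorem prime_of_isWeierstrassFactorization {g u : PowerSeries ℤ_[p]} {P : ℤ_[p][X]}
    (H : g.IsWeierstrassFactorization P u) (hP : Prime P) : Prime g := by
  have hP0 : (P : PowerSeries ℤ_[p]) ≠ 0 := fun h => hP.ne_zero (by exact_mod_cast h)
  haveI : (Ideal.span {P}).IsPrime := (Ideal.span_singleton_prime hP.ne_zero).mpr hP
  have h1 : Prime (P : PowerSeries ℤ_[p]) :=
    (Ideal.span_singleton_prime hP0).mp (span_coe_isPrime_of_dvd H.isDistinguishedAt dvd_rfl)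
  rw [H.eq_mul]
  exact (associated_mul_unit_right (P : PowerSeries ℤ_[p]) u H.isUnit).prime h1

/-- **Conversely, `g = P·u` prime in `Λ` makes `P` prime in `ℤ_p[X]`**: `Λ/(P)` is a domain and `ℤ_p[X]/(P) ≅ Λ/(P)`.
[cite: Washington1997, Prop. 7.2 and §13.2] -/
theorem prime_polynomial_of_isWeierstrassFactorization {g u : PowerSeries ℤ_[p]} {P : ℤ_[p][X]}
    (H : g.IsWeierstrassFactorization P u) (hg : Prime g) : Prime P := by
  have hPne : P ≠ 0 := H.isDistinguishedAt.monic.ne_zero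
  have hP0 : (P : PowerSeries ℤ_[p]) ≠ 0 := fun h => hPne (by exact_mod_cast h)
  have h1 : Prime (P : PowerSeries ℤ_[p]) := by
    rw [H.eq_mul] at hg
    exact (associated_mul_unit_right (P : PowerSeries ℤ_[p]) u H.isUnit).symm.prime hg
  haveI : (Ideal.span {(P : PowerSeries ℤ_[p])}).IsPrime := (Ideal.span_singleton_prime hP0).mpr h1
  haveI : IsDomain (PowerSeries ℤ_[p] ⧸ Ideal.span {(P : PowerSeries ℤ_[p])}) :=
    (Ideal.Quotient.isDomain_iff_prime _).mpr inferInstance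
  haveI : IsDomain (ℤ_[p][X] ⧸ Ideal.span {P}) :=
    MulEquiv.isDomain (PowerSeries ℤ_[p] ⧸ Ideal.span {(P : PowerSeries ℤ_[p])})
      H.isDistinguishedAt.algEquivQuotient.toMulEquiv
  exact (Ideal.span_singleton_prime hPne).mp ((Ideal.Quotient.isDomain_iff_prime _).mp inferInstance)

/-- **`g` is prime in `Λ` iff its Weierstrass polynomial `P` is prime in `ℤ_p[X]`** (for any Weierstrass factorisation `g = P·u`).
[cite: Washington1997, Thm. 7.3 and §13.2] -/
theorem prime_iff_of_isWeierstrassFactorization {g u : PowerSeries ℤ_[p]} {P : ℤ_[p][X]}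
    (H : g.IsWeierstrassFactorization P u) : Prime g ↔ Prime P :=
  ⟨prime_polynomial_of_isWeierstrassFactorization H, prime_of_isWeierstrassFactorization H⟩

/-- The same for Mathlib's chosen Weierstrass polynomial `g.weierstrassDistinguished`: for `g ≢ 0 (mod p)`,
**`g` prime in `Λ` ⟺ `weierstrassDistinguished g` prime in `ℤ_p[X]`**. [cite: Washington1997, Thm. 7.3 and §13.2] -/
theorem prime_iff_prime_weierstrassDistinguished {g : PowerSeries ℤ_[p]} (hg : g.map (IsLocalRing.residue ℤ_[p]) ≠ 0) :
    Prime g ↔ Prime (g.weierstrassDistinguished hg) :=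
  prime_iff_of_isWeierstrassFactorization (g.isWeierstrassFactorization_weierstrassDistinguished_weierstrassUnit hg)

/-- **The Weierstrass degree is `λ`**: for a Weierstrass factorisation `g = P·u`, `deg P = λ(g)` (both are the order of `g mod p`; `μ(g) = 0`).
[cite: Washington1997, Thm. 7.3] -/
theorem natDegree_eq_lam_of_isWeierstrassFactorization {g u : PowerSeries ℤ_[p]} {P : ℤ_[p][X]}
    (H : g.IsWeierstrassFactorization P u) : P.natDegree = lam g := by
  have hred : red g ≠ 0 := H.map_ne_zero
  have hg0 : g ≠ 0 := by rintro rfl; exact hred (by simp [red])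
  have hμ : mu g = 0 := by
    have hdec : g = PowerSeries.C ((p : ℤ_[p]) ^ 0) * g := by simp
    exact (mu_eq_and_pfree_eq hred hdec).1
  rw [H.natDegree_eq_toNat_order_map, lam, pfree_eq_self_of_mu_eq_zero hμ]

/-- A distinguished polynomial that is PRIME in `ℤ_p[X]` is prime in `Λ` (Weierstrass factorisation `P = P·1`).
[cite: Washington1997, Prop. 7.2 and §13.2] -/
theorem prime_coe_of_isDistinguishedAt {P : ℤ_[p][X]} (hP : P.IsDistinguishedAt (IsLocalRing.maximalIdeal ℤ_[p]))
    (hPr : Prime P) : Prime (P : PowerSeries ℤ_[p]) :=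
  prime_of_isWeierstrassFactorization (g := (P : PowerSeries ℤ_[p])) (u := 1) ⟨hP, isUnit_one, (mul_one _).symm⟩ hPr

/-! ## §2 Eisenstein ⇒ PRIME: every `H ∈ ℤ_p⟦T⟧` with `‖H(0)‖ = p⁻¹` is a prime element of `Λ` -/

/-- A non-unit of `ℤ_p` has norm `≤ p⁻¹`; an element of `𝔪² = (p²)` has norm `≤ p⁻²`. [folklore] -/
theorem norm_le_inv_sq_of_mem_maximalIdeal_sq {x : ℤ_[p]} (hx : x ∈ IsLocalRing.maximalIdeal ℤ_[p] ^ 2) :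
    ‖x‖ ≤ (p : ℝ)⁻¹ * (p : ℝ)⁻¹ := by
  rw [PadicInt.maximalIdeal_eq_span_p, Ideal.span_singleton_pow, ← PadicInt.norm_le_pow_iff_mem_span_pow] at hx
  have : (p : ℝ) ^ (-(2 : ℕ) : ℤ) = (p : ℝ)⁻¹ * (p : ℝ)⁻¹ := by
    rw [zpow_neg, zpow_natCast, pow_two, mul_inv]
  rwa [this] at hx

/-- **The Weierstrass polynomial of an `H` with `‖H(0)‖ = p⁻¹` is EISENSTEIN at `(p)`**: it is monic, its lower coefficients lie in `(p)`
(distinguished), and its constant term `P(0) = H(0)/u(0)` has valuation exactly one. [cite: Washington1997, §7.1] -/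
theorem isEisensteinAt_of_isWeierstrassFactorization {H u : PowerSeries ℤ_[p]} {P : ℤ_[p][X]}
    (HW : H.IsWeierstrassFactorization P u) (hH : ‖constantCoeff H‖ = (p : ℝ)⁻¹) :
    P.IsEisensteinAt (IsLocalRing.maximalIdeal ℤ_[p]) := by
  have hp1 : (1 : ℝ) < p := by exact_mod_cast (Fact.out : p.Prime).one_lt
  have hpinv : (0 : ℝ) < (p : ℝ)⁻¹ := by positivity
  refine HW.isDistinguishedAt.monic.isEisensteinAt_of_mem_of_notMem (Ideal.IsMaximal.ne_top inferInstance)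
    (fun hn => HW.isDistinguishedAt.mem hn) (fun hmem => ?_)
  -- `H(0) = P(0) · u(0)` with `‖u(0)‖ = 1`
  have hu : ‖constantCoeff u‖ = 1 := PadicInt.isUnit_iff.mp (PowerSeries.isUnit_iff_constantCoeff.mp HW.isUnit)
  have hP0 : ‖P.coeff 0‖ = (p : ℝ)⁻¹ := by
    have h1 : constantCoeff H = P.coeff 0 * constantCoeff u := by
      rw [HW.eq_mul, map_mul, Polynomial.constantCoeff_coe]
    rw [← hH, h1, norm_mul, hu, mul_one]
  have hle := norm_le_inv_sq_of_mem_maximalIdeal_sq hmem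
  rw [hP0] at hle
  have : (1 : ℝ) ≤ (p : ℝ)⁻¹ := by
    have h2 := div_le_div_of_nonneg_right hle hpinv.le
    rwa [div_self hpinv.ne', mul_div_assoc, div_self hpinv.ne', mul_one] at h2
  linarith [inv_lt_one_of_one_lt₀ hp1]

/-- For `‖H(0)‖ = p⁻¹` with `H ≢ 0 (mod p)`, the Weierstrass polynomial of `H` has positive degree (`H` is not a unit). [folklore] -/
theorem natDegree_pos_of_isWeierstrassFactorization {H u : PowerSeries ℤ_[p]} {P : ℤ_[p][X]}
    (HW : H.IsWeierstrassFactorization P u) (hH : ‖constantCoeff H‖ = (p : ℝ)⁻¹) : 0 < P.natDegree := by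
  have hp1 : (1 : ℝ) < p := by exact_mod_cast (Fact.out : p.Prime).one_lt
  rw [Nat.pos_iff_ne_zero]
  intro h0
  have hP1 : P = 1 := HW.isDistinguishedAt.monic.natDegree_eq_zero.mp h0
  have hHu : IsUnit H := by rw [HW.eq_mul, hP1, Polynomial.coe_one, one_mul]; exact HW.isUnit
  have h1 : ‖constantCoeff H‖ = 1 := PadicInt.isUnit_iff.mp (PowerSeries.isUnit_iff_constantCoeff.mp hHu)
  rw [hH] at h1
  exact (inv_lt_one_of_one_lt₀ hp1).ne h1

/-- ★★ **EISENSTEIN ⇒ PRIME: every `H ∈ ℤ_p⟦T⟧` whose constant term has valuation ONE is a PRIME element of `Λ`.** If `p ∣ H` then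
`H = p·H'` with `H'(0)` a unit, so `H ~ p` (prime, tree `IwasawaAlgebra.prime_C`); otherwise Weierstrass preparation writes `H = P·u` with `P`
Eisenstein (`isEisensteinAt_of_isWeierstrassFactorization`), irreducible by the Eisenstein criterion, prime in the UFD `ℤ_p[X]`, and §1 applies.
Covers `p`, `T − p·v`, and every power series with Eisenstein Weierstrass polynomial. [cite: Washington1997, §7.1 and §13.2]
[cite: GreenbergLNM1716, §5 p. 176] -/
theorem prime_of_norm_constantCoeff {H : PowerSeries ℤ_[p]} (hH : ‖constantCoeff H‖ = (p : ℝ)⁻¹) : Prime H := by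
  by_cases hred : H.map (IsLocalRing.residue ℤ_[p]) = 0
  · -- `p ∣ H`, `H = C p · H'`, `H'` a unit
    obtain ⟨H', hH'⟩ := (red_eq_zero_iff H).mp hred
    have hp1 : (1 : ℝ) < p := by exact_mod_cast (Fact.out : p.Prime).one_lt
    have hpinv : (0 : ℝ) < (p : ℝ)⁻¹ := by positivity
    have hn : ‖constantCoeff H'‖ = 1 := by
      have h1 : ‖constantCoeff H‖ = (p : ℝ)⁻¹ * ‖constantCoeff H'‖ := by
        rw [hH', map_mul, constantCoeff_C, norm_mul, PadicInt.norm_p]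
      rw [hH] at h1
      have h2 := mul_left_cancel₀ hpinv.ne' (h1.symm.trans (mul_one _).symm)
      exact h2
    have hu : IsUnit H' := PowerSeries.isUnit_iff_constantCoeff.mpr (PadicInt.isUnit_iff.mpr hn)
    rw [hH']
    exact (associated_mul_unit_right _ H' hu).prime (IwasawaAlgebra.prime_C p)
  · obtain ⟨P, u, HW⟩ := H.exists_isWeierstrassFactorization hred
    have hE := isEisensteinAt_of_isWeierstrassFactorization HW hH
    have hirr : Irreducible P :=
      hE.irreducible (Ideal.IsMaximal.isPrime inferInstance) HW.isDistinguishedAt.monic.isPrimitive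
        (natDegree_pos_of_isWeierstrassFactorization HW hH)
    exact prime_of_isWeierstrassFactorization HW (UniqueFactorizationMonoid.irreducible_iff_prime.mp hirr)

/-- `p = 2` bookkeeping: **every `H ∈ ℤ₂⟦T⟧` with `‖H(0)‖₂ = ½` is prime** (the Eisenstein cofactor of the `a₂ = +1` road, the factors
`T − 2v`, `2` itself). [cite: Washington1997, §7.1 and §13.2] -/
theorem prime_of_norm_constantCoeff_eq_half {H : PowerSeries ℤ_[2]} (hH : ‖constantCoeff H‖ = (2 : ℝ)⁻¹) : Prime H :=
  prime_of_norm_constantCoeff (p := 2) (by rw [natCast_two_inv]; exact hH)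

/-! ## §3 Linear factors `T ∓ r`, `‖r‖ < 1`, are prime -/

/-- **`T − r` is prime in `Λ` for every `r ∈ pℤ_p`** (`Λ/(T − r) ≅ ℤ_p`; here: `X − C r` is distinguished of degree one and prime in `ℤ_p[X]`).
[cite: Washington1997, Prop. 7.2] -/
theorem prime_X_sub_C_of_norm_lt_one {r : ℤ_[p]} (hr : ‖r‖ < 1) : Prime (X - C r : PowerSeries ℤ_[p]) := by
  have hmem : r ∈ IsLocalRing.maximalIdeal ℤ_[p] := PadicInt.mem_nonunits.mpr hr
  have hdist : (Polynomial.X - Polynomial.C r : ℤ_[p][X]).IsDistinguishedAt (IsLocalRing.maximalIdeal ℤ_[p]) := by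
    refine ⟨⟨fun {n} hn => ?_⟩, Polynomial.monic_X_sub_C r⟩
    rw [Polynomial.natDegree_X_sub_C] at hn
    have hn0 : n = 0 := by omega
    subst hn0
    rw [Polynomial.coeff_sub, Polynomial.coeff_X_zero, Polynomial.coeff_C_zero, zero_sub]
    exact neg_mem hmem
  have h := prime_coe_of_isDistinguishedAt hdist (Polynomial.prime_X_sub_C r)
  rwa [Polynomial.coe_sub, Polynomial.coe_X, Polynomial.coe_C] at h

/-- **`T + r` is prime in `Λ` for every `r ∈ pℤ_p`** (the tree's `prime_X_add_C_two` is `p = 2`, `r = 2`). [cite: Washington1997, Prop. 7.2] -/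
theorem prime_X_add_C_of_norm_lt_one {r : ℤ_[p]} (hr : ‖r‖ < 1) : Prime (X + C r : PowerSeries ℤ_[p]) := by
  have h := prime_X_sub_C_of_norm_lt_one (p := p) (r := -r) (by rwa [norm_neg])
  rwa [map_neg, sub_neg_eq_add] at h

/-! ## §4 The general conservation law: divisors of `c·∏ S`, `S` a multiset of primes -/

section Monoid

variable {M : Type*} [CommMonoidWithZero M] [IsCancelMulZero M]

/-- ★ **DIVISORS OF A PRODUCT OF PRIMES, NO UFD.** In a cancellative commutative monoid with zero: if `a·b = ∏ S` and every member of the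
multiset `S` is prime, then `a ~ ∏ T` for some sub-multiset `T ≤ S` (induction on `S`: the first prime divides `a` or `b`; cancel it).
[folklore] -/
theorem exists_le_associated_prod_of_mul_eq_prod (S : Multiset M) (hS : ∀ P ∈ S, Prime P) {a b : M} (h : a * b = S.prod) :
    ∃ T ≤ S, Associated a T.prod := by
  induction S using Multiset.induction generalizing a b with
  | empty =>
    refine ⟨0, le_rfl, ?_⟩
    rw [Multiset.prod_zero] at h ⊢
    exact associated_one_iff_isUnit.mpr (IsUnit.of_mul_eq_one b h)
  | cons P S ih =>
    have hP : Prime P := hS P (Multiset.mem_cons_self P S)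
    have hS' : ∀ Q ∈ S, Prime Q := fun Q hQ => hS Q (Multiset.mem_cons_of_mem hQ)
    rw [Multiset.prod_cons] at h
    have hdvd : P ∣ a * b := ⟨S.prod, h⟩
    rcases hP.dvd_or_dvd hdvd with ⟨a', rfl⟩ | ⟨b', rfl⟩
    · have h' : a' * b = S.prod := mul_left_cancel₀ hP.ne_zero (by rw [← mul_assoc, h])
      obtain ⟨T, hT, hassoc⟩ := ih hS' h'
      exact ⟨P ::ₘ T, Multiset.cons_le_cons P hT, by rw [Multiset.prod_cons]; exact hassoc.mul_left P⟩
    · have h' : a * b' = S.prod := mul_left_cancel₀ hP.ne_zero (by rw [mul_left_comm, h])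
      obtain ⟨T, hT, hassoc⟩ := ih hS' h'
      exact ⟨T, hT.trans (Multiset.le_cons_self S P), hassoc⟩

/-- The same with a unit in front: `a·b = u·∏ S`, `u` a unit, members of `S` prime ⇒ `a ~ ∏ T`, `T ≤ S`. [folklore] -/
theorem exists_le_associated_prod_of_mul_eq_unit_mul_prod (S : Multiset M) (hS : ∀ P ∈ S, Prime P) {a b u : M} (hu : IsUnit u)
    (h : a * b = u * S.prod) : ∃ T ≤ S, Associated a T.prod := by
  obtain ⟨v, rfl⟩ := hu
  refine exists_le_associated_prod_of_mul_eq_prod S hS (b := b * ↑v⁻¹) ?_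
  rw [← mul_assoc, h, mul_comm, ← mul_assoc, Units.inv_mul, one_mul]

/-- A sub-multiset of `replicate n q + S` splits as `replicate m q + T` with `m ≤ n`, `T ≤ S`. [folklore] -/
theorem exists_eq_replicate_add_of_le {α : Type*} [DecidableEq α] {U S : Multiset α} {q : α} {n : ℕ}
    (h : U ≤ Multiset.replicate n q + S) : ∃ m : ℕ, m ≤ n ∧ ∃ T ≤ S, U = Multiset.replicate m q + T := by
  have h1 : U - Multiset.replicate n q ≤ S := Multiset.sub_le_iff_le_add.mpr (by rwa [add_comm] at h)
  have h2 : U ∩ Multiset.replicate n q ≤ Multiset.replicate n q := Multiset.inter_le_right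
  obtain ⟨m, hm, hUm⟩ := Multiset.le_replicate_iff.mp h2
  refine ⟨m, hm, U - Multiset.replicate n q, h1, ?_⟩
  rw [← hUm, add_comm, Multiset.sub_add_inter]

end Monoid

/-- `λ` of a product of non-zero power series is the sum of the `λ`'s. [cite: Washington1997, §7.1] -/
theorem lam_multiset_prod (T : Multiset (PowerSeries ℤ_[p])) (h0 : (0 : PowerSeries ℤ_[p]) ∉ T) :
    lam T.prod = (T.map lam).sum := by
  induction T using Multiset.induction with
  | empty => rw [Multiset.prod_zero, Multiset.map_zero, Multiset.sum_zero]; exact lam_eq_zero_of_isUnit isUnit_one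
  | cons P T ih =>
    have hP : P ≠ 0 := fun h => h0 (h ▸ Multiset.mem_cons_self P T)
    have hT : (0 : PowerSeries ℤ_[p]) ∉ T := fun h => h0 (Multiset.mem_cons_of_mem h)
    rw [Multiset.prod_cons, Multiset.map_cons, Multiset.sum_cons, lam_mul hP (Multiset.prod_ne_zero hT), ih hT]

/-- `μ` of a product of non-zero power series is the sum of the `μ`'s. [cite: Washington1997, §7.1] -/
theorem mu_multiset_prod (T : Multiset (PowerSeries ℤ_[p])) (h0 : (0 : PowerSeries ℤ_[p]) ∉ T) :
    mu T.prod = (T.map mu).sum := by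
  induction T using Multiset.induction with
  | empty => rw [Multiset.prod_zero, Multiset.map_zero, Multiset.sum_zero]; exact mu_eq_zero_of_isUnit isUnit_one
  | cons P T ih =>
    have hP : P ≠ 0 := fun h => h0 (h ▸ Multiset.mem_cons_self P T)
    have hT : (0 : PowerSeries ℤ_[p]) ∉ T := fun h => h0 (Multiset.mem_cons_of_mem h)
    rw [Multiset.prod_cons, Multiset.map_cons, Multiset.sum_cons, mu_mul hP (Multiset.prod_ne_zero hT), ih hT]

/-- The constant term of a product has norm the product of the norms. [folklore] -/
theorem norm_constantCoeff_multiset_prod (T : Multiset (PowerSeries ℤ_[p])) :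
    ‖constantCoeff T.prod‖ = (T.map fun P => ‖constantCoeff P‖).prod := by
  induction T using Multiset.induction with
  | empty => rw [Multiset.prod_zero, Multiset.map_zero, Multiset.prod_zero, map_one, norm_one]
  | cons P T ih => rw [Multiset.prod_cons, Multiset.map_cons, Multiset.prod_cons, map_mul, norm_mul, ih]

/-- An associate has the same `λ`, `μ` and constant-term norm. [folklore] -/
theorem lam_mu_norm_of_associated {F G : PowerSeries ℤ_[p]} (h : Associated F G) (hG : G ≠ 0) :
    lam F = lam G ∧ mu F = mu G ∧ ‖constantCoeff F‖ = ‖constantCoeff G‖ := by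
  obtain ⟨v, rfl⟩ := h
  have hF : F ≠ 0 := by rintro rfl; exact hG (zero_mul _)
  have hv : IsUnit (v : PowerSeries ℤ_[p]) := v.isUnit
  refine ⟨?_, ?_, ?_⟩
  · rw [lam_mul hF hv.ne_zero, lam_eq_zero_of_isUnit hv, add_zero]
  · rw [mu_mul hF hv.ne_zero, mu_eq_zero_of_isUnit hv, add_zero]
  · rw [map_mul, norm_mul, PadicInt.isUnit_iff.mp (PowerSeries.isUnit_iff_constantCoeff.mp hv), mul_one]

/-- `λ(C(p^m)) = 0`, `μ(C(p^m)) = m`, `‖C(p^m)(0)‖ = p^{−m}`. [folklore] -/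
theorem lam_mu_norm_C_pow (m : ℕ) :
    lam (C ((p : ℤ_[p]) ^ m) : PowerSeries ℤ_[p]) = 0 ∧ mu (C ((p : ℤ_[p]) ^ m) : PowerSeries ℤ_[p]) = m ∧
      ‖constantCoeff (C ((p : ℤ_[p]) ^ m) : PowerSeries ℤ_[p])‖ = (p : ℝ)⁻¹ ^ m := by
  have hp0 : ((p : ℤ_[p]) ^ m) ≠ 0 := pow_ne_zero _ (by exact_mod_cast (Fact.out : p.Prime).ne_zero)
  have hdec : (C ((p : ℤ_[p]) ^ m) : PowerSeries ℤ_[p]) = C ((p : ℤ_[p]) ^ m) * 1 := (mul_one _).symm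
  have hred1 : red (1 : PowerSeries ℤ_[p]) ≠ 0 := by simp [red]
  obtain ⟨hmu, -⟩ := mu_eq_and_pfree_eq hred1 hdec
  refine ⟨LambdaConstPinch.lam_C hp0, hmu, ?_⟩
  rw [constantCoeff_C, norm_pow, PadicInt.norm_p, inv_pow]

/-- ★★ **THE GENERAL CONSERVATION LAW IN `Λ`.** Let `F·A = C(p^n)·∏ S` in `ℤ_p⟦T⟧`, where every member of the multiset `S` is a PRIME
element with `μ = 0` (a `p`-free prime: an Eisenstein series, a `ℚ_p`-irreducible distinguished polynomial, a linear factor `T − r`, …).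
Then for some `m ≤ n` and some sub-multiset `T ≤ S` (the KEPT factors): **`λ(F) = Σ_{P∈T} λ(P)`, `μ(F) = m`,
`‖F(0)‖ = p^{−m}·∏_{P∈T} ‖P(0)‖`** — i.e. `F = p^m·∏ T·unit`. This is Kato's shape `f_X·a = pⁿ·L₀` once the integral `p`-adic
`L`-function has a certified prime factorisation; BSD's unit equation then reads `p^{μ} = ∏_{dropped} ‖P(0)‖⁻¹`.
[cite: Washington1997, §7.1 and §13.2] [cite: Kato2004Asterisque, Thm. 17.4 (2) (p. 273)] [cite: GreenbergLNM1716, §5 pp. 176–182] -/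
theorem divisor_of_C_pow_mul_prod {F A : PowerSeries ℤ_[p]} {n : ℕ} {S : Multiset (PowerSeries ℤ_[p])}
    (hS : ∀ P ∈ S, Prime P) (hSμ : ∀ P ∈ S, mu P = 0) (h : F * A = C ((p : ℤ_[p]) ^ n) * S.prod) :
    ∃ m : ℕ, m ≤ n ∧ ∃ T ≤ S, lam F = (T.map lam).sum ∧ mu F = m ∧
      ‖constantCoeff F‖ = (p : ℝ)⁻¹ ^ m * (T.map fun P => ‖constantCoeff P‖).prod := by
  have hpC : Prime (C (p : ℤ_[p]) : PowerSeries ℤ_[p]) := IwasawaAlgebra.prime_C p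
  -- all factors of `replicate n (C p) + S` are prime
  set S' : Multiset (PowerSeries ℤ_[p]) := Multiset.replicate n (C (p : ℤ_[p])) + S with hS'_def
  have hS' : ∀ P ∈ S', Prime P := by
    intro P hP
    rcases Multiset.mem_add.mp hP with h1 | h1
    · rw [Multiset.eq_of_mem_replicate h1]; exact hpC
    · exact hS P h1
  have h' : F * A = S'.prod := by
    rw [h, hS'_def, Multiset.prod_add, Multiset.prod_replicate, map_pow]
  obtain ⟨U, hU, hassoc⟩ := exists_le_associated_prod_of_mul_eq_prod S' hS' h'
  obtain ⟨m, hm, T, hT, rfl⟩ := exists_eq_replicate_add_of_le hU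
  have h0T : (0 : PowerSeries ℤ_[p]) ∉ T := fun h0 => (hS 0 (Multiset.mem_of_le hT h0)).ne_zero rfl
  have hTprod : T.prod ≠ 0 := Multiset.prod_ne_zero h0T
  have hCpm : (C ((p : ℤ_[p]) ^ m) : PowerSeries ℤ_[p]) ≠ 0 := C_pow_ne_zero m
  have hprod : (Multiset.replicate m (C (p : ℤ_[p])) + T).prod = C ((p : ℤ_[p]) ^ m) * T.prod := by
    rw [Multiset.prod_add, Multiset.prod_replicate, map_pow]
  rw [hprod] at hassoc
  obtain ⟨hlam, hmu, hnorm⟩ := lam_mu_norm_of_associated hassoc (mul_ne_zero hCpm hTprod)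
  obtain ⟨hlamC, hmuC, hnormC⟩ := lam_mu_norm_C_pow (p := p) m
  have hμT : (T.map mu).sum = 0 := by
    apply Multiset.sum_eq_zero
    intro x hx
    obtain ⟨P, hP, rfl⟩ := Multiset.mem_map.mp hx
    exact hSμ P (Multiset.mem_of_le hT hP)
  refine ⟨m, hm, T, hT, ?_, ?_, ?_⟩
  · rw [hlam, lam_mul hCpm hTprod, hlamC, zero_add, lam_multiset_prod T h0T]
  · rw [hmu, mu_mul hCpm hTprod, hmuC, mu_multiset_prod T h0T, hμT, add_zero]
  · rw [hnorm, map_mul, norm_mul, hnormC, norm_constantCoeff_multiset_prod]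

/-- **One-step peeling.** `F·A = C(c)·(Q·R)` with `Q` prime: EITHER `F = Q·F₁` with `F₁·A = C(c)·R`, OR `F·A₁ = C(c)·R` for some `A₁`
(`Q` went into `A`). The finite, multiset-free form used on the road for explicit two- and three-factor shapes. [folklore] -/
theorem exists_eq_mul_or_of_mul_eq_C_mul_mul {F A Q R : PowerSeries ℤ_[p]} {c : ℤ_[p]} (hQ : Prime Q)
    (h : F * A = C c * (Q * R)) :
    (∃ F₁ : PowerSeries ℤ_[p], F = Q * F₁ ∧ F₁ * A = C c * R) ∨ (∃ A₁ : PowerSeries ℤ_[p], F * A₁ = C c * R) := by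
  have hdvd : Q ∣ F * A := ⟨C c * R, by rw [h]; ring⟩
  rcases hQ.dvd_or_dvd hdvd with ⟨F₁, rfl⟩ | ⟨A₁, rfl⟩
  · refine Or.inl ⟨F₁, rfl, mul_left_cancel₀ hQ.ne_zero ?_⟩
    calc Q * (F₁ * A) = Q * F₁ * A := by ring
      _ = C c * (Q * R) := h
      _ = Q * (C c * R) := by ring
  · refine Or.inr ⟨A₁, mul_left_cancel₀ hQ.ne_zero ?_⟩
    calc Q * (F * A₁) = F * (Q * A₁) := by ring
      _ = C c * (Q * R) := h
      _ = Q * (C c * R) := by ring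

end Summit.BirchSwinnertonDyer.BirchSwinnertonDyer.Theorems.AlignedTransportAtTwoEisensteinRigidityPrime

end
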